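import Summits.QuantumFields.YangMills.Theorems.BalabanLadderUVSeamRecCeilingsResponseCarriers
import Summits.QuantumFields.YangMills.Theorems.BalabanLadderUVSeamRecCeilingsResponseMomentsUnit
import HarnessLib

/-!
# Crux `UVSeamRec` (stmt-QuantumFields-20043): the carriers press-button AT THE REGISTERED STUB — (split) + K-fold carrier
# moments at `SU(2)`, fundamental representation, any unit eventually `≤ c·uRec` ⇒ the body of `stub_responseMomentsOdd6` BY NAME

Helper file (`--supports stmt-QuantumFields-20043`) of the width-lever seat `ym-20043-ceilings-p2` (lane B, gen 2); sequel of
p535725 `…CeilingsResponseCarriers.lean`.  The slot of record is v5(α) (owner ruling R86k, registry write #9, skeleton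
afcf556d5b76a240): ONE non-fed stub `BirthV5A.stub_responseMomentsOdd6 : UV → (RM-package)`, where (RM-package) is the hypothesis of
p532738 `stubCeilings_of_responseMoments` — `∃ a c C₁ B β₁ ℓ₁ P₀ p, 0 < c ∧ (∀ᶠ β, a β ≤ c·Transport.uRec β) ∧ 0 < ℓ₁ ∧ 0 < C₁ ∧
(∀ q β, |p q β| ≤ P₀) ∧ (RM at unit a, SU(2), fundamentalLatticeRep 2)`.  This file states the (β)-architecture press-buttons of
p535725 with EXACTLY that conclusion (modulo the skeleton's `letI := borel _`), so that a closer of the stub writes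
`exact responseMomentsOdd6_of_quadratic_and_polymerLaw …` after `letI`/`haveI`.  HONEST FRAMING: composition only; the carriers'
laws ((split), (EM_Q), (PL)) are OPEN (E0′-K with background; Gaussian domination; Bałaban large-field estimates at levels
k ≥ 1 on odd tori); nothing of E0′; not a gap, not Clay.

* `responseMomentsOdd6_of_carriers` — K carriers, B = A₀ + B'.
* `responseMomentsOdd6_of_quadratic_and_polymerLaw` — quadratic carrier (doubled moments) + large-field carrier from a polymer product
  law with constant budgets Λ, W; B = A₀ + max(B_Q, 2e^{2Λ}W).

References: as p535725 / p532738 (Georgii (2011) Thm. 4.17 for the DLR part).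
-/

set_option autoImplicit false

noncomputable section

open MeasureTheory Filter Topology Finset
open Literature.MathematicalPhysics.QuantumFieldTheory (GaugeConfig LatticeRep)
open Literature.MathematicalPhysics.QuantumLattice

namespace Summit.QuantumFields.YangMills.Cruxes.UVSeamRec.TemperedResponse

open Summit.QuantumFields.YangMills.Cruxes.OSLegsFromFemtoAndGap.DlrCollarTransfer

section Unit

variable [MeasurableSpace (Matrix.specialUnitaryGroup (Fin 2) ℂ)] [BorelSpace (Matrix.specialUnitaryGroup (Fin 2) ℂ)]

/-- **The body of `stub_responseMomentsOdd6` from CARRIERS.**  At `SU(2)`, fundamental representation, a unit `a` with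
`a β ≤ c·uRec β` eventually (`c > 0`), constants `C₁ > 0`, `ℓ₁ > 0`, `A₀`, `B'`, bounded reference values `p`: a pointwise split of the
rescaled cube response into `K ≥ 1` bounded measurable carriers for ALL exteriors plus K-fold joint exponential moments of each carrier on
every odd torus and separated family give the registered stub's conclusion with `B = A₀ + B'` (p535725 `responseMoments_of_carriers`).
[folklore] -/
theorem responseMomentsOdd6_of_carriers {K : ℕ} (hK : 0 < K) {a : ℝ → ℝ} {c C₁ β₁ ℓ₁ A₀ B' P₀ : ℝ}
    {p : Fin 4 × Fin 4 → ℝ → ℝ} (hc : 0 < c) (hle : ∀ᶠ β in atTop, a β ≤ c * Transport.uRec β) (hℓ₁ : 0 < ℓ₁)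
    (hC₁ : 0 < C₁) (hp : ∀ q β, |p q β| ≤ P₀)
    (Y : Fin K → ℝ → ℕ → Fin 4 × Fin 4 → (Fin 4 → ℤ) → LGConfig 4 (Matrix.specialUnitaryGroup (Fin 2) ℂ) → ℝ) (MY : ℝ → ℕ → ℝ)
    (hYm : ∀ k β R q x, Measurable (Y k β R q x)) (hYb : ∀ k β R q x η, |Y k β R q x η| ≤ MY β R)
    (hsplit : ∀ β : ℝ, β₁ ≤ β → ∀ R : ℕ, 1 ≤ R → (R : ℝ) * a β ≤ ℓ₁ →
      ∀ (q : Fin 4 × Fin 4) (x : Fin 4 → ℤ), q.1 < q.2 → ∀ η : LGConfig 4 (Matrix.specialUnitaryGroup (Fin 2) ℂ),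
        (R : ℝ) ^ 4 / C₁ * |kerE (Matrix.specialUnitaryGroup (Fin 2) ℂ) (fundamentalLatticeRep 2) β (fun k => x k - (R + 1)) (2 * R + 3) η
          (plane (Matrix.specialUnitaryGroup (Fin 2) ℂ) (fundamentalLatticeRep 2) q x) - p q β| ≤ A₀ + ∑ k, Y k β R q x η)
    (hEM : ∀ k : Fin K, ∀ β : ℝ, β₁ ≤ β → ∀ (L n : ℕ) (q : Fin n → Fin 4 × Fin 4) (x : Fin n → (Fin 4 → ℤ)) (R : ℕ),
      (∀ i, (q i).1 < (q i).2) → 1 ≤ R → (R : ℝ) * a β ≤ ℓ₁ → 4 * R + 8 ≤ L →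
      (∀ i j : Fin n, i ≠ j → ∃ k : Fin 4,
        (2 * (R : ℤ) + 4) ≤ |((((x i k - x j k : ℤ) : ZMod (2 * L + 1))).valMinAbs : ℤ)|) →
      ∀ T : Finset (Fin n),
        torusE (Matrix.specialUnitaryGroup (Fin 2) ℂ) (fundamentalLatticeRep 2) β L (fun U => Real.exp ((K : ℝ) * ∑ i ∈ T, Y k β R (q i) (x i) U)) ≤
          Real.exp (B' * T.card)) :
    ∃ (a : ℝ → ℝ) (c : ℝ) (C₁ B β₁ ℓ₁ P₀ : ℝ) (p : Fin 4 × Fin 4 → ℝ → ℝ), 0 < c ∧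
      (∀ᶠ β in atTop, a β ≤ c * Transport.uRec β) ∧ 0 < ℓ₁ ∧ 0 < C₁ ∧ (∀ q β, |p q β| ≤ P₀) ∧
      ∀ β : ℝ, β₁ ≤ β → ∀ (L n : ℕ) (q : Fin n → Fin 4 × Fin 4) (x : Fin n → (Fin 4 → ℤ)) (R : ℕ),
        (∀ i, (q i).1 < (q i).2) → 1 ≤ R → (R : ℝ) * a β ≤ ℓ₁ → 4 * R + 8 ≤ L →
        (∀ i j : Fin n, i ≠ j → ∃ k : Fin 4,
          (2 * (R : ℤ) + 4) ≤ |((((x i k - x j k : ℤ) : ZMod (2 * L + 1))).valMinAbs : ℤ)|) →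
        ∀ T : Finset (Fin n),
          torusE (Matrix.specialUnitaryGroup (Fin 2) ℂ) (fundamentalLatticeRep 2) β L
            (fun U => Real.exp (∑ i ∈ T, (R : ℝ) ^ 4 / C₁ *
              |kerE (Matrix.specialUnitaryGroup (Fin 2) ℂ) (fundamentalLatticeRep 2) β (fun k => x i k - (R + 1)) (2 * R + 3) U
                (plane (Matrix.specialUnitaryGroup (Fin 2) ℂ) (fundamentalLatticeRep 2) (q i) (x i)) - p (q i) β|)) ≤ Real.exp (B * T.card) :=
  ⟨a, c, C₁, A₀ + B', β₁, ℓ₁, P₀, p, hc, hle, hℓ₁, hC₁, hp,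
    responseMoments_of_carriers (fundamentalLatticeRep 2) a hK Y MY hYm hYb hsplit hEM⟩

/-- **The body of `stub_responseMomentsOdd6` from the (β) split «quadratic + large-field carrier with polymer product law».**  At
`SU(2)`, fundamental representation, unit `a ≤ c·uRec` eventually: (split) `(R⁴/C₁)|kerE − p| ≤ A₀ + Q + LF` for ALL exteriors; (EM_Q)
`⟨exp(2ΣQ_i∘lift)⟩ ≤ e^{B_Q·#T}`; (PL) for LF with constant budgets Λ, W (p528131's typing) ⇒ the registered stub's conclusion with
`B = A₀ + max(B_Q, 2e^{2Λ}W)` (p535725 `responseMoments_of_quadratic_and_polymerLaw`).  A closer of v5(α)'s stub along the (β)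
architecture ends with `exact responseMomentsOdd6_of_quadratic_and_polymerLaw …`. [folklore] -/
theorem responseMomentsOdd6_of_quadratic_and_polymerLaw {a : ℝ → ℝ} {c C₁ β₁ ℓ₁ A₀ B_Q Λ W P₀ : ℝ}
    {p : Fin 4 × Fin 4 → ℝ → ℝ} (hc : 0 < c) (hle : ∀ᶠ β in atTop, a β ≤ c * Transport.uRec β) (hℓ₁ : 0 < ℓ₁)
    (hC₁ : 0 < C₁) (hp : ∀ q β, |p q β| ≤ P₀)
    (Q LF : ℝ → ℕ → Fin 4 × Fin 4 → (Fin 4 → ℤ) → LGConfig 4 (Matrix.specialUnitaryGroup (Fin 2) ℂ) → ℝ) (MY : ℝ → ℕ → ℝ)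
    (hQm : ∀ β R q x, Measurable (Q β R q x)) (hQb : ∀ β R q x η, |Q β R q x η| ≤ MY β R)
    (hLFm : ∀ β R q x, Measurable (LF β R q x)) (hLFb : ∀ β R q x η, |LF β R q x η| ≤ MY β R)
    (hsplit : ∀ β : ℝ, β₁ ≤ β → ∀ R : ℕ, 1 ≤ R → (R : ℝ) * a β ≤ ℓ₁ →
      ∀ (q : Fin 4 × Fin 4) (x : Fin 4 → ℤ), q.1 < q.2 → ∀ η : LGConfig 4 (Matrix.specialUnitaryGroup (Fin 2) ℂ),
        (R : ℝ) ^ 4 / C₁ * |kerE (Matrix.specialUnitaryGroup (Fin 2) ℂ) (fundamentalLatticeRep 2) β (fun k => x k - (R + 1)) (2 * R + 3) η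
          (plane (Matrix.specialUnitaryGroup (Fin 2) ℂ) (fundamentalLatticeRep 2) q x) - p q β| ≤ A₀ + Q β R q x η + LF β R q x η)
    (hEMQ : ∀ β : ℝ, β₁ ≤ β → ∀ (L n : ℕ) (q : Fin n → Fin 4 × Fin 4) (x : Fin n → (Fin 4 → ℤ)) (R : ℕ),
      (∀ i, (q i).1 < (q i).2) → 1 ≤ R → (R : ℝ) * a β ≤ ℓ₁ → 4 * R + 8 ≤ L →
      (∀ i j : Fin n, i ≠ j → ∃ k : Fin 4,
        (2 * (R : ℤ) + 4) ≤ |((((x i k - x j k : ℤ) : ZMod (2 * L + 1))).valMinAbs : ℤ)|) →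
      ∀ T : Finset (Fin n),
        torusE (Matrix.specialUnitaryGroup (Fin 2) ℂ) (fundamentalLatticeRep 2) β L
          (fun U => Real.exp (((2 : ℕ) : ℝ) * ∑ i ∈ T, Q β R (q i) (x i) U)) ≤ Real.exp (B_Q * T.card))
    (hPL : ∀ β : ℝ, β₁ ≤ β → ∀ (L n : ℕ) (q : Fin n → Fin 4 × Fin 4) (x : Fin n → (Fin 4 → ℤ)) (R : ℕ),
      (∀ i, (q i).1 < (q i).2) → 1 ≤ R → (R : ℝ) * a β ≤ ℓ₁ → 4 * R + 8 ≤ L →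
      (∀ i j : Fin n, i ≠ j → ∃ k : Fin 4,
        (2 * (R : ℤ) + 4) ≤ |((((x i k - x j k : ℤ) : ZMod (2 * L + 1))).valMinAbs : ℤ)|) →
      ∃ (κ : Type) (S : Finset κ) (E : κ → Set (LGConfig 4 (Matrix.specialUnitaryGroup (Fin 2) ℂ))) (w : κ → ℝ) (cf : Fin n → κ → ℝ),
        (∀ γ, MeasurableSet (E γ)) ∧ (∀ γ ∈ S, 0 ≤ w γ) ∧ (∀ i, ∀ γ ∈ S, 0 ≤ cf i γ) ∧
        (∀ (i : Fin n) (U : GaugeConfig 4 (2 * L + 1) (Matrix.specialUnitaryGroup (Fin 2) ℂ)),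
          LF β R (q i) (x i) (torusLift (2 * L + 1) U) ≤
            ∑ γ ∈ S, cf i γ * (E γ).indicator (fun _ => (1 : ℝ)) (torusLift (2 * L + 1) U)) ∧
        (∀ γ ∈ S, ∑ i, cf i γ ≤ Λ) ∧ (∀ i, ∑ γ ∈ S, cf i γ * w γ ≤ W) ∧
        (∀ A, A ⊆ S → torusE (Matrix.specialUnitaryGroup (Fin 2) ℂ) (fundamentalLatticeRep 2) β L
          (fun U => ∏ γ ∈ A, (E γ).indicator (fun _ => (1 : ℝ)) U) ≤ ∏ γ ∈ A, w γ)) :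
    ∃ (a : ℝ → ℝ) (c : ℝ) (C₁ B β₁ ℓ₁ P₀ : ℝ) (p : Fin 4 × Fin 4 → ℝ → ℝ), 0 < c ∧
      (∀ᶠ β in atTop, a β ≤ c * Transport.uRec β) ∧ 0 < ℓ₁ ∧ 0 < C₁ ∧ (∀ q β, |p q β| ≤ P₀) ∧
      ∀ β : ℝ, β₁ ≤ β → ∀ (L n : ℕ) (q : Fin n → Fin 4 × Fin 4) (x : Fin n → (Fin 4 → ℤ)) (R : ℕ),
        (∀ i, (q i).1 < (q i).2) → 1 ≤ R → (R : ℝ) * a β ≤ ℓ₁ → 4 * R + 8 ≤ L →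
        (∀ i j : Fin n, i ≠ j → ∃ k : Fin 4,
          (2 * (R : ℤ) + 4) ≤ |((((x i k - x j k : ℤ) : ZMod (2 * L + 1))).valMinAbs : ℤ)|) →
        ∀ T : Finset (Fin n),
          torusE (Matrix.specialUnitaryGroup (Fin 2) ℂ) (fundamentalLatticeRep 2) β L
            (fun U => Real.exp (∑ i ∈ T, (R : ℝ) ^ 4 / C₁ *
              |kerE (Matrix.specialUnitaryGroup (Fin 2) ℂ) (fundamentalLatticeRep 2) β (fun k => x i k - (R + 1)) (2 * R + 3) U
                (plane (Matrix.specialUnitaryGroup (Fin 2) ℂ) (fundamentalLatticeRep 2) (q i) (x i)) - p (q i) β|)) ≤ Real.exp (B * T.card) :=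
  ⟨a, c, C₁, A₀ + max B_Q (2 * Real.exp (2 * Λ) * W), β₁, ℓ₁, P₀, p, hc, hle, hℓ₁, hC₁, hp,
    responseMoments_of_quadratic_and_polymerLaw (fundamentalLatticeRep 2) a Q LF MY hQm hQb hLFm hLFb hsplit hEMQ hPL⟩

end Unit

end Summit.QuantumFields.YangMills.Cruxes.UVSeamRec.TemperedResponse

end
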